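import Summits.QuantumFields.BalabanUV.Beta.EriceFlowEnclosureB12AsPrintedTuned
import Summits.QuantumFields.BalabanUV.Beta.EriceFlowEnclosureB12AsPrintedLastVarEnd

/-!
# Beta / EriceFlowEnclosureB12AsPrintedTunedWitness — non-vacuity of the tuned-run junction: forward-solution coupling tables obey (0.20) inside
# the interval (the binder `hrg` of `…B12AsPrintedTuned`), and the last-variable toy of `…B12AsPrintedLastVarEnd` satisfies Theorem 2, `hrg` and
# the whole as-printed interface while violating every k-uniform last-variable letter (β-flow team, prover 1, unit `b2b-balaban-beta-bflow-p1`,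
# gen 32; ROW AP-I)

HONEST FRAMING (page 1 of everything the β sub-cell writes): discharging `BetaPertH` makes Bałaban's UV stability UNCONDITIONAL — a
real constructive-QFT result; it is NOT the continuum limit and NOT the Clay problem.  HONEST DEPENDENCY (cell reorg 2026-08-19,
verbatim): «continuum YM on T⁴ ⇐ BetaPertH ∧ nine spine estimates (0/9 proved); BetaPertH ⇐ (D1) ∧ (D4) ∧ CAP+tail; G-an2-4 gates
asym, D1 and NE2/3/4.»  THIS MODULE DISCHARGES NOTHING: [folklore] bookkeeping on TOY settings of ours for the statement-exact typing of
[I] = [Balaban1987RG1] (`B12BetaAsPrinted`, p537882 ✓ ∕ v1.1 p539116 ✓); nothing of Bałaban's objects is asserted; `hrg`, Theorem 2 and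
every interface field remain HYPOTHESES for the construction.

WHAT THIS FILE PROVES (0 sorry, 0 def):
§1 **`hrg_of_forwardRuns`** (defining hypotheses: the coupling table is the `Nat.rec` forward solution of (0.20) with a last-variable step
   function F, and β at run prefixes is F ⟹ `Step.InInterval γ K ⟹ FlowStep.RGEqH K β`: a positive forward solution had a positive right
   side at every step, since 1∕√(≤ 0) = 0).
§2 `betaContH_of_toyBeta` (joint continuity of the last-variable toy on every box); **`tunedHypotheses_nonvacuous`** (∃ S hH, Definitions ∧
   Conclusions ∧ B12BetaAsPrinted ∧ `hrg` ∧ `Theorem2Statement S hL` ∧ ∀ C, ¬`LastVarLipschitz S.β C γ` — the hypotheses of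
   `…B12AsPrintedTuned` are jointly satisfiable, by a setting violating row I1's k-uniform letter: Theorem 2 AS PRINTED does not require
   it); `rate_bound_nonvacuous` (`theorem2_rate_le_betaPrime510` instantiated: on the toy, Theorem 2's lower constant β satisfies
   β·ln 13 ≤ β′₅₁₀ = MQ(1, 4)·Σ_x|x|₁²e^{−|x|₁} as an actual inequality).
NOT CLAIMED: `hrg`, Theorem 2 or any interface field for the construction; `BetaPertH`; continuum; Clay.
-/

namespace Summit.QuantumFields.BalabanUV.Beta.EriceFlowEnclosureB12AsPrintedTunedWitness

open Literature.MathematicalPhysics.QuantumFieldTheory.Balaban1983to89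
open Literature.MathematicalPhysics.QuantumFieldTheory.Balaban1983to89.B12BetaAsPrinted
open Literature.MathematicalPhysics.QuantumFieldTheory.Balaban1983to89.B12Sec2to5 (betaPrime510)
open Literature.MathematicalPhysics.QuantumFieldTheory.Balaban1983to89.FlowStep (prefixOf Box BetaContH BetaLowerH BetaUpperH)
open Literature.MathematicalPhysics.QuantumFieldTheory.Balaban1983to89.BetaDerivClause (LastVarLipschitz)
open Summit.QuantumFields.BalabanUV.Beta.EriceFlowEnclosureB12AsPrintedUpper
open Summit.QuantumFields.BalabanUV.Beta.EriceFlowEnclosureB12AsPrintedWitness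
open Summit.QuantumFields.BalabanUV.Beta.EriceFlowEnclosureB12AsPrintedLastVar
open Summit.QuantumFields.BalabanUV.Beta.EriceFlowEnclosureB12AsPrintedLastVarEnd
open Summit.QuantumFields.BalabanUV.Beta.EriceFlowEnclosureB12AsPrintedTuned

noncomputable section

variable {S : Setting}

/-! ## §1 Forward-solution coupling tables obey (0.20) inside the interval: the binder `hrg` of `…B12AsPrintedTuned` for such settings -/

/-- **A forward solution of (0.20) that stays positive DID have a positive right side at every step** — so (0.20) holds along it.  For a
setting whose coupling table is the `Nat.rec` forward solution with a last-variable step function `F` and whose β at run prefixes is `F`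
(defining hypotheses): `Step.InInterval γ K (g_·) ⟹ FlowStep.RGEqH K β (g_·)` — the binder `hrg`.  (If 1∕g_k² − F k g_k ≤ 0 the table's
next entry is 1∕√(≤ 0) = 0, not in ]0, γ].) [cite: Balaban1987RG1, (0.20) p.256] -/
theorem hrg_of_forwardRuns (F : ℕ → ℝ → ℝ)
    (hcpl : ∀ (P : B12.RunParams) (k : ℕ), S.cpl P k =
      Nat.rec (motive := fun _ => ℝ) P.g0 (fun k g => 1 / Real.sqrt (1 / g ^ 2 - F k g)) k)
    (hβF : ∀ (P : B12.RunParams) (k : ℕ), S.β k (prefixOf (S.cpl P) k) = F k (S.cpl P k))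
    (P : B12.RunParams) (hI : Step.InInterval S.γ P.K (S.cpl P)) : FlowStep.RGEqH P.K S.β (S.cpl P) := by
  intro k hk
  have hpos := (hI (k + 1) hk).1
  have hsucc : S.cpl P (k + 1) = 1 / Real.sqrt (1 / (S.cpl P k) ^ 2 - F k (S.cpl P k)) := by
    rw [hcpl, hcpl]
  have hrad : 0 < 1 / (S.cpl P k) ^ 2 - F k (S.cpl P k) := by
    by_contra hle
    rw [hsucc, Real.sqrt_eq_zero'.mpr (not_lt.mp hle), div_zero] at hpos
    exact lt_irrefl 0 hpos
  rw [hβF, hsucc, div_pow, one_pow, Real.sq_sqrt hrad.le, one_div_one_div]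
  ring

/-! ## §2 The hypotheses of `…B12AsPrintedTuned` are jointly satisfiable — by a setting violating every k-uniform last-variable letter -/

/-- Joint continuity of the last-variable toy β on every box (composition of the smooth profile with the last-coordinate projection).
[folklore] -/
theorem betaContH_of_toyBeta
    (hβ : ∀ (k : ℕ) (p : Fin (k + 1) → ℝ), S.β k p =
      1 / 100 + 1 / 100 * ((k : ℝ) * p (Fin.last k) / (1 + ((k : ℝ) * p (Fin.last k)) ^ 2)))
    (γ : ℝ) : BetaContH γ S.β := by
  intro k
  have e : S.β k = fun p : Fin (k + 1) → ℝ => 1 / 100 + 1 / 100 * ((k : ℝ) * p (Fin.last k) / (1 + ((k : ℝ) * p (Fin.last k)) ^ 2)) :=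
    funext (hβ k)
  rw [e]
  have hc : Continuous fun p : Fin (k + 1) → ℝ => 1 / 100 + 1 / 100 * ((k : ℝ) * p (Fin.last k) / (1 + ((k : ℝ) * p (Fin.last k)) ^ 2)) :=
    (toyBeta_contDiff (k : ℝ) (n := 0)).continuous.comp (continuous_apply (Fin.last k))
  exact hc.continuousOn

/-- **THE LAST-VARIABLE TOY SATISFIES THEOREM 2 AND THE BINDER `hrg`.**  There is a setting with `StandingHypotheses ∧ Definitions ∧ Conclusions
∧ B12BetaAsPrinted` whose couplings obey (0.20) inside the interval (`hrg`), for which `Theorem2Statement S hL` HOLDS (letters b = 1∕200,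
b′ = 3∕200, joint continuity — `…B12AsPrintedUpper.theorem2Statement_of_letters`), and which nevertheless violates `LastVarLipschitz S.β C γ` for
EVERY C: the hypotheses of `…B12AsPrintedTuned` are jointly satisfiable, and Theorem 2 as printed does not require the k-uniform
last-variable letter either. [cite: Balaban1987RG1, Thm 2 p.259 with p.264 (β-clause after (1.22))] -/
theorem tunedHypotheses_nonvacuous :
    ∃ S : Setting, ∃ hH : StandingHypotheses S, Definitions S ∧ Conclusions S ∧ B12BetaAsPrinted S ∧
      (∀ P : B12.RunParams, Step.InInterval S.γ P.K (S.cpl P) → FlowStep.RGEqH P.K S.β (S.cpl P)) ∧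
      Theorem2Statement S (hL_of_standing hH) ∧ ∀ C : ℝ, ¬ LastVarLipschitz S.β C S.γ := by
  obtain ⟨S, hβ, hcpl, hγ, -, hH, hD, hC⟩ := toyLastVar_exists
  have hβF : ∀ (P : B12.RunParams) (k : ℕ), S.β k (prefixOf (S.cpl P) k) =
      1 / 100 + 1 / 100 * ((k : ℝ) * S.cpl P k / (1 + ((k : ℝ) * S.cpl P k) ^ 2)) := fun P k => by
    rw [hβ]; simp [prefixOf]
  have hrg := hrg_of_forwardRuns (fun k g => 1 / 100 + 1 / 100 * ((k : ℝ) * g / (1 + ((k : ℝ) * g) ^ 2))) hcpl hβF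
  have hlo : BetaLowerH (1 / 200) S.γ S.β := fun k v _ => by rw [hβ]; exact (toyBeta_mem _ _).1
  have hup : BetaUpperH (3 / 200) S.γ S.β := fun k v _ => by rw [hβ]; exact (toyBeta_mem _ _).2
  have hγpos : 0 < S.γ := by rw [hγ]; norm_num
  exact ⟨S, hH, hD, hC, fun _ _ => hC, hrg,
    theorem2Statement_of_letters hH hD hγpos (by norm_num) (by norm_num) (betaContH_of_toyBeta hβ S.γ) hlo hup,
    not_lastVarLipschitz_of_toyBeta hβ hγ⟩

/-- Hence `…B12AsPrintedTuned.theorem2_rate_le_betaPrime510` is NOT vacuous: on the last-variable toy its conclusion is an actual inequality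
between Theorem 2's lower constant (here ≥ ln 13∕200 is admissible) and print's β′₅₁₀ = MQ(1, 4)·Σ_x|x|₁²e^{−|x|₁}. [cite: Balaban1987RG1, Thm 2 (0.31) p.259 with (5.10) p.293] -/
theorem rate_bound_nonvacuous :
    ∃ S : Setting, ∃ hH : StandingHypotheses S, ∃ _hT : Theorem2Statement S (hL_of_standing hH), ∀ m : ℕ,
      ∃ γ₀ : ℝ, 0 < γ₀ ∧ ∀ γ : ℝ, 0 < γ → γ ≤ γ₀ → γ ≤ S.γ → ∃ g₁ : ℝ, 0 < g₁ ∧ ∀ g : ℝ, 0 < g → g ≤ g₁ →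
        ∃ β β' : ℝ, 0 < β ∧ β ≤ β' ∧ β * Real.log S.L ≤ betaPrime510 4 (S.C510 * S.E₀) S.δ₁ ∧ ∀ K : ℕ, ∃ g₀ : ℝ,
          RunHyp S ⟨K, m, g₀⟩ ∧ S.cpl ⟨K, m, g₀⟩ K = g ∧
            Step.Discrete031 (β * Real.log S.L) (min (β' * Real.log S.L) (betaPrime510 4 (S.C510 * S.E₀) S.δ₁)) K g
              (S.cpl ⟨K, m, g₀⟩) := by
  obtain ⟨S, hH, hD, hC, -, hrg, hT, -⟩ := tunedHypotheses_nonvacuous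
  exact ⟨S, hH, hT, fun m => theorem2_rate_le_betaPrime510 hT hrg hD hC m⟩

end

end Summit.QuantumFields.BalabanUV.Beta.EriceFlowEnclosureB12AsPrintedTunedWitness
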